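import Summits.QuantumFields.QCD.Theses.NestedDissectionSea
import Summits.QuantumFields.QCD.Theorems.CoerciveSea.Negative.PinWindow

/-!
# Line `twisted-sixth-moment` — skeleton for crux `CoerciveSea` (stmt-QuantumFields-13901)

Route `NestedDissectionSea`, crux `CoerciveSea` (the hinge, rank 3).  Idea card
`Cruxes/CoerciveSea/Ideas/twisted-sixth-moment.md` (ideator 1; triage r1: pass ×3, merge-with
`twisted-spectral-sum` noted).  Crux-plan seat `planner-cruxplan-stmt-QuantumFields-13901-twisted-sixth-moment-0`.

THE LINE.  Clause (i) of `CoerciveSea` (SEPARATOR WEGNER LAW IN THE WINDOW: the phase-quenched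
probability of a `(t/s₀)`-singular separator of a window cell is `≤ C t^α`, uniformly in `k`,
volume and box) is dominated, configuration by configuration, by ONE bounded real-analytic
gauge-invariant cell observable, the twisted sixth moment
`M₃(U, μ, s, τ) = τ⁶ · Re Tr (D_c† D_c + τ²)⁻³`, `D_c = wilsonCell U μ 0 s`, `τ = t/s₀`
(`twistedMoment`; `= twistedSum/8` of the sibling card `twisted-spectral-sum`):
a `τ`-singular separator gives `λ_min(D_c†D_c) < τ²`, hence `M₃ ≥ τ⁶(2τ²)⁻³ = 1/8`
(`stub_dominates`, Markov through the spectral theorem), and `M₃` is a polynomial in the twisted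
cell propagators `(D_c ± iτΓ₅)⁻¹`, bounded by `1/τ` for EVERY gauge field (no exceptional
configurations: `stub_noExceptional`).  So (i) follows from a bound on ONE phase-quenched
EXPECTATION, `E_pq[M₃(t/s₀)] ≤ C t^α` — the format every engine controlling the measure outputs.
The skeleton cuts that expectation bound where the physics cuts it:

* `stub_kineticEdge` (= clause (b) of route support `KineticEdge`, stmt-13899, provable now):
  a `τ`-singular separator needs kinetic room `Σ_i (1 − cos(π/s_i)) < τ − μ`; so at `t ≤ 1` every
  cell with `Σ_i (1 − cos(π/s_i)) ≥ 1/s₀ − m_f(k)` has an EMPTY event and clause (i) lives only on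
  kinetically admissible (mesoscopic, `s ≳ |m_crit(k)|^{-1/2} → ∞`) cells — the moment bound is
  asked only there ("dislocation blindness" at the kinematic level);
* `stub_femtoLaw` (HARDEST): along one pinned regularisation (clauses (ii),(iii) of the crux
  verbatim, honouring `coerciveSeaWithoutPin_holds`: all content enters through the pin), for
  every physical size `R ≥ R₁` the moment bound holds on tori of physical side in `[R, 2R]` with
  constants allowed to depend on `R` — the FEMTO-UNIVERSE statement (fixed physical volume, window
  cells of physical side `≤ ℓ ≪ 1/Λ`: the regime of Bałaban / Magnen–Rivasseau–Sénéor small-field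
  control, i.e. the bridge's bosonic sea flow with one marked twisted source);
* `stub_volumeTransfer`: beyond some `R₀` the constants can be taken volume-independent — the
  thermodynamic-limit (DLR-type) control of ONE positive cell-local observable of the pinned,
  massive phase-quenched measure (triage r1-3's requested stub).

`CoerciveSea_of : CoerciveSea` composes the five stubs into the crux BY NAME; everything outside
`stub_*` is kernel-checked (no `sorry`): the hypothesis-form composition `coerciveSeaAt_of_laws`
(axioms `propext/Classical.choice/Quot.sound`), the Markov step in ratio form (`ratio_markov`), the
kinetic case split, monotonicity of (ii),(iii) in `R`, and the definitional repacking through the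
landed `CoerciveSeaNegative.coerciveSea_iff`.
-/

noncomputable section

open scoped BigOperators ComplexConjugate Classical
open MeasureTheory Filter Matrix
open Literature.MathematicalPhysics.QuantumLattice Literature.MathematicalPhysics.QuantumFieldTheory
  Literature.Probability.LatticeModels
open Summit.QuantumFields.QCD.Theorems.CoerciveSeaNegative

namespace Summit.QuantumFields.QCD.Cruxes.CoerciveSea.TwistedSixthMoment

/-- Local notation: the colour group `SU(3)`. -/
local notation "𝔾" => Matrix.specialUnitaryGroup (Fin 3) ℂ

/-! ## The observable -/

/-- The **twisted sixth moment** of the Dirichlet cell of corner `0` and sides `s` at bare mass `μ`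
and twist `τ`: `M₃(U, μ, s, τ) = τ⁶ · Re Tr (D_c† D_c + τ²)⁻³ = τ⁶ Σ_i (σ_i² + τ²)⁻³` over the
singular values `σ_i` of `D_c = wilsonCell U μ 0 s`; equivalently `τ⁶ Tr [(D_c + iτΓ₅ᶜ)⁻¹
(D_c − iτΓ₅ᶜ)⁻¹]³` (twisted-mass cell propagators, `‖(D_c ± iτΓ₅ᶜ)⁻¹‖ ≤ 1/τ` for every `U`).
The idea card's `M₃`; the sibling card's `twistedSum = 8 · M₃`. -/
def twistedMoment {N : ℕ} [NeZero N] (U : GaugeConfig 4 N 𝔾) (μ : ℝ) (s : Fin 4 → ℕ) (τ : ℝ) : ℝ :=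
  τ ^ 6 * (Matrix.trace (((wilsonCell U μ 0 s)ᴴ * wilsonCell U μ 0 s +
      ((τ ^ 2 : ℝ) : ℂ) • (1 : Matrix {p // wilsonBox (0 : TorusSite 4 N) s p}
        {p // wilsonBox (0 : TorusSite 4 N) s p} ℂ))⁻¹ ^ 3)).re

/-! ## Clause abbreviations (VERBATIM pieces of the crux; `PinClause` is the landed one) -/

section Clauses

variable (Nf : ℕ) (reg : QCDRegularisation Nf) (b₀ : ℕ) (ℓ : ℝ) (m : Fin Nf → ℝ) (R : ℝ)

/-- Clause (i) of `CoerciveSea` (SEPARATOR WEGNER LAW IN THE WINDOW) at the data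
`(reg, b₀, ℓ, m, R)`, VERBATIM. -/
def SeparatorLaw : Prop :=
  ∃ C : ℝ, 0 < C ∧ ∃ α : ℝ, 0 < α ∧ ∀ᶠ k : ℕ in Filter.atTop, ∀ S : ℕ, R ≤ reg.a k * (2 * S + 1) → let N : ℕ := 2 * S + 1; let mq : Fin Nf → ℝ := fun f => reg.mcrit k + reg.a k * m f / reg.Zm k; let wt : GaugeConfig 4 N (Matrix.specialUnitaryGroup (Fin 3) ℂ) → ℝ := fun U => ∏ f, ‖fermionDet (wilsonDirac (fundamentalRep (Fin 3)) U (mq f) 1)‖; let P : (GaugeConfig 4 N (Matrix.specialUnitaryGroup (Fin 3) ℂ) → Prop) → ℝ := fun E => (∫ U, (if E U then (1 : ℝ) else 0) * wt U ∂(wilsonMeasure (d := 4) (L := N) (fundamentalRep (Fin 3)) (reg.β k))) / (∫ U, wt U ∂(wilsonMeasure (d := 4) (L := N) (fundamentalRep (Fin 3)) (reg.β k))); ∀ s : Fin 4 → ℕ, (∀ i, b₀ ≤ s i ∧ s i ≤ N ∧ (s i : ℝ) * reg.a k ≤ ℓ) → (∀ i j, s i ≤ 2 * s j) → ∀ f :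 Fin Nf, ∀ t : ℝ, 0 < t → t ≤ 1 → P (fun U => HasSingularSeparator U (mq f) s (t / s 0)) ≤ C * t ^ α

/-- Clause (ii) of `CoerciveSea` (WINDOWED LOCAL DILUTION, = `NegativeCellsDilute` (a)) at the data
`(reg, b₀, ℓ, m, R)`, VERBATIM. -/
def DilutionClause : Prop :=
  ∀ ε : ℝ, 0 < ε → ∀ᶠ k : ℕ in Filter.atTop, ∀ S : ℕ, R ≤ reg.a k * (2 * S + 1) → let N : ℕ := 2 * S + 1; let mq : Fin Nf → ℝ := fun f => reg.mcrit k + reg.a k * m f / reg.Zm k; let wt : GaugeConfig 4 N (Matrix.specialUnitaryGroup (Fin 3) ℂ) → ℝ := fun U => ∏ f, ‖fermionDet (wilsonDirac (fundamentalRep (Fin 3)) U (mq f) 1)‖; let P : (GaugeConfig 4 N (Matrix.specialUnitaryGroup (Fin 3) ℂ) → Prop) → ℝ := fun E => (∫ U, (if E U then (1 : ℝ) else 0) * wt U ∂(wilsonMeasure (d := 4) (L := N) (fundamentalRep (Fin 3)) (reg.β k))) / (∫ U, wt U ∂(wilsonMeasure (d := 4) (L := N) (fundamentalRep (Fin 3))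 (reg.β k))); let J : ℕ := Nat.log 2 (⌊ℓ / reg.a k⌋₊ / b₀) + 1; ∃ δ : ℕ → ℝ, ∑ j ∈ Finset.range J, δ j ≤ ε ∧ ∀ j < J, ∀ s : Fin 4 → ℕ, (∀ i, b₀ * 2 ^ j ≤ s i ∧ s i < b₀ * 2 ^ (j + 2) ∧ s i ≤ N ∧ (s i : ℝ) * reg.a k ≤ ℓ) → P (fun U => ∃ f, IsSignDefect U (mq f) j s) ≤ δ j

/-- **The twisted moment law (all volumes)** at the data `(reg, b₀, ℓ, m, R)`: for some `C, α > 0`,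
eventually in `k`, on EVERY odd torus of physical side `≥ R`, for every roughly cubic corner-`0`
window box `s` (`b₀ ≤ s_i ≤ N`, `s_i a_k ≤ ℓ`, `s_i ≤ 2 s_j`), every flavour `f` whose cell is
KINETICALLY ADMISSIBLE (`Σ_i (1 − cos(π/s_i)) < 1/s₀ − m_f(k)`; the other cells carry no
`(t/s₀)`-singular separator at any `t ≤ 1`, `stub_kineticEdge`) and every `t ∈ (0,1]`, the
phase-quenched EXPECTATION of `M₃(U, m_f(k), s, t/s₀)` is `≤ C t^α`. -/
def MomentLaw : Prop :=
  ∃ C : ℝ, 0 < C ∧ ∃ α : ℝ, 0 < α ∧ ∀ᶠ k : ℕ in Filter.atTop, ∀ S : ℕ, R ≤ reg.a k * (2 * S + 1) → let N : ℕ := 2 * S + 1; let mq : Fin Nf → ℝ := fun f => reg.mcrit k + reg.a k * m f / reg.Zm k; let wt : GaugeConfig 4 N (Matrix.specialUnitaryGroup (Fin 3) ℂ) → ℝ := fun U => ∏ f, ‖fermionDet (wilsonDirac (fundamentalRep (Fin 3)) U (mq f) 1)‖; let Ex : (GaugeConfig 4 N (Matrix.specialUnitaryGroup (Fin 3) ℂ)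 → ℝ) → ℝ := fun F => (∫ U, F U * wt U ∂(wilsonMeasure (d := 4) (L := N) (fundamentalRep (Fin 3)) (reg.β k))) / (∫ U, wt U ∂(wilsonMeasure (d := 4) (L := N) (fundamentalRep (Fin 3)) (reg.β k))); ∀ s : Fin 4 → ℕ, (∀ i, b₀ ≤ s i ∧ s i ≤ N ∧ (s i : ℝ) * reg.a k ≤ ℓ) → (∀ i j, s i ≤ 2 * s j) → ∀ f : Fin Nf, (∑ i, (1 - Real.cos (Real.pi / s i)) < 1 / (s 0 : ℝ) - mq f) → ∀ t : ℝ, 0 < t → t ≤ 1 → Ex (fun U => twistedMoment U (mq f) s (t / s 0)) ≤ C * t ^ α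

/-- **The twisted moment law in the femto-universe** at the data `(reg, b₀, ℓ, m, R)`: the same
bound, but only on odd tori of physical side in `[R, 2R]` (FIXED physical volume; the constants
`C, α` may depend on `R`). -/
def FemtoMomentLaw : Prop :=
  ∃ C : ℝ, 0 < C ∧ ∃ α : ℝ, 0 < α ∧ ∀ᶠ k : ℕ in Filter.atTop, ∀ S : ℕ, R ≤ reg.a k * (2 * S + 1) → reg.a k * (2 * S + 1) ≤ 2 * R → let N : ℕ := 2 * S + 1; let mq : Fin Nf → ℝ := fun f => reg.mcrit k + reg.a k * m f / reg.Zm k; let wt : GaugeConfig 4 N (Matrix.specialUnitaryGroup (Fin 3) ℂ) → ℝ := fun U => ∏ f, ‖fermionDet (wilsonDirac (fundamentalRep (Fin 3)) U (mq f) 1)‖; let Ex : (GaugeConfig 4 N (Matrix.specialUnitaryGroup (Fin 3) ℂ) → ℝ) → ℝ := fun F => (∫ U, F U * wt U ∂(wilsonMeasure (d := 4) (L := N) (fundamentalRep (Fin 3)) (reg.β k))) / (∫ U, wt U ∂(wilsonMeasure (d := 4) (L := N) (fundamentalRep (Fin 3)) (reg.β k))); ∀ s : Fin 4 → ℕ,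 (∀ i, b₀ ≤ s i ∧ s i ≤ N ∧ (s i : ℝ) * reg.a k ≤ ℓ) → (∀ i j, s i ≤ 2 * s j) → ∀ f : Fin Nf, (∑ i, (1 - Real.cos (Real.pi / s i)) < 1 / (s 0 : ℝ) - mq f) → ∀ t : ℝ, 0 < t → t ≤ 1 → Ex (fun U => twistedMoment U (mq f) s (t / s 0)) ≤ C * t ^ α

end Clauses

/-! ## The five registered stubs -/

/-- **stub_dominates** (the card's first lemma `TwistedSixthMomentDominates`; deterministic,
provable now, size S–M).  A `τ`-singular separator (`τ > 0`) forces `M₃ ≥ 1/8`: the separator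
vector `w` is harmonic on the children interiors, so its full residual is its separator residual,
`‖D_c w‖² < τ² ‖w‖²` (landed: `CoerciveSeaNegative.hasSingularSeparator_cell_residual_lt`), hence
`λ_min(D_c†D_c) < τ²` (Rayleigh), `D_c†D_c + τ²` is positive definite and
`Tr (D_c†D_c + τ²)⁻³ ≥ (λ_min + τ²)⁻³ > (2τ²)⁻³` (spectral theorem, `Matrix.IsHermitian.eigenvalues`).
Markov's inequality in its configuration-wise form: `1_{HasSingularSeparator} ≤ 8 M₃`. -/
theorem stub_dominates :
    ∀ (N : ℕ) [NeZero N] (U : GaugeConfig 4 N 𝔾) (μ : ℝ) (s : Fin 4 → ℕ) (τ : ℝ),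
      0 < τ → HasSingularSeparator U μ s τ → (1 / 8 : ℝ) ≤ twistedMoment U μ s τ := by
  sorry

/-- **stub_noExceptional** ("no exceptional configurations"; deterministic + routine measure
theory, provable now, size M).  For `τ > 0` and EVERY gauge field, `0 ≤ M₃ ≤ #box`: each singular
value contributes `(τ²/(σ_i² + τ²))³ ∈ [0, 1]` — the configuration-free bound behind
`(D_c + iτΓ₅ᶜ)†(D_c + iτΓ₅ᶜ) = D_c†D_c + τ²` (`γ₅`-hermiticity survives Dirichlet restriction;
Frezzotti–Grassi–Sint–Weisz: the twisted mass protects against zero modes for every background);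
and `U ↦ M₃(U) · ∏_f |det D_W(U, m_f)|` is integrable against the finite-volume Wilson measure
(continuous in `U` on the compact configuration space — the inverse of a uniformly positive definite
matrix depending polynomially on the links — times a continuous weight, against a probability
measure).  This is what makes `E_pq[M₃]` an honest (non-junk) Bochner expectation. -/
theorem stub_noExceptional :
    ∀ (N : ℕ) [NeZero N] (β μ τ : ℝ) (s : Fin 4 → ℕ) (n : ℕ) (mq : Fin n → ℝ), 0 < τ →
      (∀ U : GaugeConfig 4 N 𝔾, 0 ≤ twistedMoment U μ s τ ∧
          twistedMoment U μ s τ ≤ Fintype.card {p // wilsonBox (0 : TorusSite 4 N) s p}) ∧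
        Integrable (fun U : GaugeConfig 4 N 𝔾 => twistedMoment U μ s τ *
            ∏ f, ‖fermionDet (wilsonDirac (fundamentalRep (Fin 3)) U (mq f) 1)‖)
          (wilsonMeasure (d := 4) (L := N) (fundamentalRep (Fin 3)) β) := by
  sorry

/-- **stub_kineticEdge** (= clause (b) of route support `KineticEdge`, stmt-QuantumFields-13899;
deterministic, provable now, size M–L).  KINETIC EDGE for near-singular separators: if the corner-`0`
cell of sides `s ≤ N` has a `τ`-singular separator (`τ ≥ 0`) at bare mass `μ`, then
`Σ_i (1 − cos(π/s_i)) < τ − μ` — the harmonic extension `w` has `‖D_c w‖ < τ‖w‖`, its covariant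
kinetic energy `⟨w, (4 − A_U) w⟩ < (τ − μ)‖w‖²`, and the lattice diamagnetic inequality with the top
eigenvalue `Σ_i cos(π/s_i)` of the free hopping on the open box gives the edge.  Consequence used by
`CoerciveSea_of`: at `t ≤ 1` every cell with `Σ_i (1 − cos(π/s_i)) ≥ 1/s₀ − m_f(k)` has an EMPTY
`(t/s₀)`-separator event, so the moment law is needed only on kinetically admissible cells
(`s ≳ π (2/|m_f(k)|)^{1/2} → ∞` on the pinned branch). -/
theorem stub_kineticEdge :
    ∀ (N : ℕ) [NeZero N] (U : GaugeConfig 4 N 𝔾) (s : Fin 4 → ℕ) (μ τ : ℝ), 0 ≤ τ →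
      (∀ i, s i ≤ N) → HasSingularSeparator U μ s τ →
        ∑ i, (1 - Real.cos (Real.pi / s i)) < τ - μ := by
  sorry

/-- **stub_femtoLaw** (HARDEST; the transfer `C⁺` of the card in its fixed-physical-volume form).
For `N_f ∈ {2,3}` there is ONE mass-independent regularisation `reg` (`HasMassScaling`,
`HasAsymptoticScaling`), `M₀ ≥ 0`, a leaf size `b₀ ≥ 2` and a physical window `ℓ > 0` such that for
every mass tuple `m > M₀` there is `R₁ > 0` with:
(i♭) for EVERY physical size `R ≥ R₁`, the twisted moment law on odd tori of physical side in
`[R, 2R]` (`FemtoMomentLaw`; constants may depend on `R`): the phase-quenched expectation of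
`M₃(U, m_f(k), s, t/s₀)` over kinetically admissible roughly cubic window boxes is `≤ C_R t^{α_R}`,
eventually in `k`, uniformly in the box, the flavour and `t ∈ (0,1]`;
(ii) the windowed local dilution of `CoerciveSea`/`NegativeCellsDilute`, VERBATIM, at `R₁`;
(iii) the parity pin, VERBATIM (landed `CoerciveSeaNegative.PinClause`), at `R₁`.
Engine named by the card: in a window cell (`s a_k ≤ ℓ ≪ 1/Λ`, Dirichlet/SF-like conditioning, no
torons) `E[M₃] = ` (small-field bulk `≍ t⁶`, uniform order by order after mass renormalisation)
` + ` (one-lump sector, `(s a_k Λ)^b ×` a moduli integral, UV-convergent end of the instanton measure)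
` + ` (large-field remainder) — a Bałaban block RG / MRS93-type phase-space expansion of the
phase-quenched SU(3) measure with ONE marked twisted source, i.e. the bridge's `BosonicSeaFlow` run
down to the cell scale (triage r1-2).  Clauses (ii),(iii) ride along because the crux shares its
`∃ reg` with `NegativeCellsDilute` (stmt-13900); the pin is what places `m_f(k)` on the physical
branch (`coerciveSeaWithoutPin_holds`: without it (i),(ii) are junk-true). -/
theorem stub_femtoLaw :
    ∀ Nf : ℕ, (Nf = 2 ∨ Nf = 3) → ∃ reg : QCDRegularisation Nf, reg.HasMassScaling ∧
      (reg.scheme 0 0 0).HasAsymptoticScaling ∧ ∃ M₀ : ℝ, 0 ≤ M₀ ∧ ∃ b₀ : ℕ, 2 ≤ b₀ ∧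
        ∃ ℓ : ℝ, 0 < ℓ ∧ ∀ m : Fin Nf → ℝ, (∀ f, M₀ < m f) → ∃ R₁ : ℝ, 0 < R₁ ∧
          (∀ R : ℝ, R₁ ≤ R → FemtoMomentLaw Nf reg b₀ ℓ m R) ∧
            DilutionClause Nf reg b₀ ℓ m R₁ ∧ PinClause Nf reg M₀ m R₁ := by
  sorry

/-- **stub_volumeTransfer** (thermodynamic-limit control of ONE positive cell-local observable;
size L).  For an admissible regularisation whose parity pin holds at `(M₀, m, R₁)` (so `mcrit` sits
on the physical branch and the valence masses `m > M₀` are in the massive, symmetric phase), there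
is `R₀ > 0` such that for every `R ≥ max(R₀, R₁)` the femto-universe moment law at `R` (tori of side
in `[R, 2R]`, `R`-dependent constants) upgrades to the all-volume moment law at `R` (ONE pair
`(C, α)` for every odd torus of physical side `≥ R`): the phase-quenched law of the links of a
window cell depends on the torus only through boundary effects a physical distance `≥ R − ℓ` away,
and for a POSITIVE local observable dominated by local rare events those change its expectation by
a bounded factor, uniformly in `k`, box, flavour and `t` (DLR / cluster-expansion decoupling in the
gapped phase; triage r1-3: "the engine must deliver the bound uniformly in the torus volume `S` at
fixed `k` — say so as a stub"). -/
theorem stub_volumeTransfer :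
    ∀ Nf : ℕ, (Nf = 2 ∨ Nf = 3) → ∀ (reg : QCDRegularisation Nf) (M₀ : ℝ) (b₀ : ℕ) (ℓ : ℝ)
      (m : Fin Nf → ℝ) (R₁ : ℝ), reg.HasMassScaling → (reg.scheme 0 0 0).HasAsymptoticScaling →
        0 ≤ M₀ → 2 ≤ b₀ → 0 < ℓ → (∀ f, M₀ < m f) → 0 < R₁ → PinClause Nf reg M₀ m R₁ →
          ∃ R₀ : ℝ, 0 < R₀ ∧ ∀ R : ℝ, R₀ ≤ R → R₁ ≤ R →
            FemtoMomentLaw Nf reg b₀ ℓ m R → MomentLaw Nf reg b₀ ℓ m R := by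
  sorry

/-! ## Kernel-checked composition -/

/-- Markov's inequality in phase-quenched RATIO form (generic): if `E ⊆ {1/8 ≤ M}`, `M, wt ≥ 0` and
`M · wt` is integrable, then `(∫ 1_E wt)/(∫ wt) ≤ 8 · (∫ M wt)/(∫ wt)`. [folklore] -/
theorem ratio_markov {Ω : Type*} [MeasurableSpace Ω] (μ : Measure Ω) (E : Ω → Prop)
    (M wt : Ω → ℝ) (hM : ∀ x, 0 ≤ M x) (hwt : ∀ x, 0 ≤ wt x) (hE : ∀ x, E x → (1 / 8 : ℝ) ≤ M x)
    (hint : Integrable (fun x => M x * wt x) μ) :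
    (∫ x, (if E x then (1 : ℝ) else 0) * wt x ∂μ) / (∫ x, wt x ∂μ) ≤
      8 * ((∫ x, M x * wt x ∂μ) / (∫ x, wt x ∂μ)) := by
  have key : ∫ x, (if E x then (1 : ℝ) else 0) * wt x ∂μ ≤ ∫ x, 8 * (M x * wt x) ∂μ := by
    apply integral_mono_of_nonneg
    · exact Filter.Eventually.of_forall fun x =>
        show (0 : ℝ) ≤ (if E x then (1 : ℝ) else 0) * wt x from
          mul_nonneg (by split_ifs <;> norm_num) (hwt x)
    · exact hint.const_mul 8
    · exact Filter.Eventually.of_forall fun x => by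
        show (if E x then (1 : ℝ) else 0) * wt x ≤ 8 * (M x * wt x)
        by_cases hx : E x
        · rw [if_pos hx]
          have h1 := hE x hx
          have h2 := hwt x
          nlinarith
        · rw [if_neg hx, zero_mul]
          exact mul_nonneg (by norm_num) (mul_nonneg (hM x) (hwt x))
  rw [integral_const_mul] at key
  rw [← mul_div_assoc]
  exact div_le_div_of_nonneg_right key (integral_nonneg fun x => hwt x)

/-- Clause (ii) is monotone in the physical size `R` (fewer tori). [folklore] -/
theorem dilutionClause_mono {Nf : ℕ} {reg : QCDRegularisation Nf} {b₀ : ℕ} {ℓ : ℝ}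
    {m : Fin Nf → ℝ} {R₁ R : ℝ} (hR : R₁ ≤ R) (h : DilutionClause Nf reg b₀ ℓ m R₁) :
    DilutionClause Nf reg b₀ ℓ m R := by
  intro ε hε
  filter_upwards [h ε hε] with k hk S hS
  exact hk S (hR.trans hS)

/-- The pin (iii) is monotone in the physical size `R`. [folklore] -/
theorem pinClause_mono {Nf : ℕ} {reg : QCDRegularisation Nf} {M₀ : ℝ} {m : Fin Nf → ℝ}
    {R₁ R : ℝ} (hR : R₁ ≤ R) (h : PinClause Nf reg M₀ m R₁) : PinClause Nf reg M₀ m R := by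
  intro M hM
  filter_upwards [h M hM] with k hk S hS
  exact hk S (hR.trans hS)

/-- **From the all-volume moment law to clause (i)** (kernel-checked): on kinetically admissible
cells Markov in ratio form with `stub_dominates`/`stub_noExceptional` (`P ≤ 8·E[M₃] ≤ 8C t^α`);
on the other cells the event is empty by `stub_kineticEdge` (`P = 0`). -/
theorem separatorLaw_of_momentLaw
    (hdom : ∀ (N : ℕ) [NeZero N] (U : GaugeConfig 4 N 𝔾) (μ : ℝ) (s : Fin 4 → ℕ) (τ : ℝ),
      0 < τ → HasSingularSeparator U μ s τ → (1 / 8 : ℝ) ≤ twistedMoment U μ s τ)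
    (hobs : ∀ (N : ℕ) [NeZero N] (β μ τ : ℝ) (s : Fin 4 → ℕ) (n : ℕ) (mq : Fin n → ℝ), 0 < τ →
      (∀ U : GaugeConfig 4 N 𝔾, 0 ≤ twistedMoment U μ s τ ∧
          twistedMoment U μ s τ ≤ Fintype.card {p // wilsonBox (0 : TorusSite 4 N) s p}) ∧
        Integrable (fun U : GaugeConfig 4 N 𝔾 => twistedMoment U μ s τ *
            ∏ f, ‖fermionDet (wilsonDirac (fundamentalRep (Fin 3)) U (mq f) 1)‖)
          (wilsonMeasure (d := 4) (L := N) (fundamentalRep (Fin 3)) β))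
    (hkin : ∀ (N : ℕ) [NeZero N] (U : GaugeConfig 4 N 𝔾) (s : Fin 4 → ℕ) (μ τ : ℝ), 0 ≤ τ →
      (∀ i, s i ≤ N) → HasSingularSeparator U μ s τ →
        ∑ i, (1 - Real.cos (Real.pi / s i)) < τ - μ)
    {Nf : ℕ} {reg : QCDRegularisation Nf} {b₀ : ℕ} {ℓ : ℝ} {m : Fin Nf → ℝ} {R : ℝ}
    (hb₀ : 2 ≤ b₀) (hmom : MomentLaw Nf reg b₀ ℓ m R) : SeparatorLaw Nf reg b₀ ℓ m R := by
  obtain ⟨C, hC, α, hα, hk⟩ := hmom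
  refine ⟨8 * C, by positivity, α, hα, ?_⟩
  filter_upwards [hk] with k hk S hS
  have hkS := hk S hS
  intro N mq wt P s hs hcub f t ht0 ht1
  have hs0 : (0 : ℝ) < (s 0 : ℝ) := by
    have h := (hs 0).1
    exact_mod_cast (show 0 < s 0 by omega)
  have hτ : 0 < t / (s 0 : ℝ) := div_pos ht0 hs0
  have hCt : 0 ≤ 8 * C * t ^ α := by positivity
  have hwt : ∀ U, 0 ≤ wt U := fun U => Finset.prod_nonneg fun f _ => norm_nonneg _
  by_cases hks : ∑ i, (1 - Real.cos (Real.pi / s i)) < 1 / (s 0 : ℝ) - mq f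
  · -- kinetically admissible cell: Markov in ratio form
    have hEx := hkS s hs hcub f hks t ht0 ht1
    obtain ⟨hbd, hint⟩ := hobs N (reg.β k) (mq f) (t / s 0) s Nf mq hτ
    have hP := ratio_markov (wilsonMeasure (d := 4) (L := N) (fundamentalRep (Fin 3)) (reg.β k))
      (fun U => HasSingularSeparator U (mq f) s (t / s 0))
      (fun U => twistedMoment U (mq f) s (t / s 0)) wt (fun U => (hbd U).1) hwt
      (fun U hU => hdom N U (mq f) s (t / s 0) hτ hU) hint
    calc P (fun U => HasSingularSeparator U (mq f) s (t / s 0))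
        ≤ 8 * ((∫ U, twistedMoment U (mq f) s (t / s 0) * wt U
              ∂(wilsonMeasure (d := 4) (L := N) (fundamentalRep (Fin 3)) (reg.β k))) /
            (∫ U, wt U ∂(wilsonMeasure (d := 4) (L := N) (fundamentalRep (Fin 3)) (reg.β k)))) := hP
      _ ≤ 8 * (C * t ^ α) := mul_le_mul_of_nonneg_left hEx (by norm_num)
      _ = 8 * C * t ^ α := (mul_assoc _ _ _).symm
  · -- kinetically forbidden cell: the event is empty
    have hempty : ∀ U : GaugeConfig 4 N 𝔾, ¬ HasSingularSeparator U (mq f) s (t / s 0) := by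
      intro U hU
      have h1 := hkin N U s (mq f) (t / s 0) hτ.le (fun i => (hs i).2.1) hU
      have h2 : t / (s 0 : ℝ) ≤ 1 / (s 0 : ℝ) := div_le_div_of_nonneg_right ht1 hs0.le
      exact hks (by linarith)
    simp only [P, hempty, if_false, zero_mul, integral_zero, zero_div]
    exact hCt

/-- **The composition, hypothesis form** (kernel-checked, sorry-free, axioms `propext`,
`Classical.choice`, `Quot.sound`): the five stub STATEMENTS imply the crux body
`∀ N_f ∈ {2,3}, ∃ reg, CoerciveSeaAt N_f reg` (the landed verbatim unfolding of `CoerciveSea`,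
`CoerciveSeaNegative.coerciveSea_iff`).  Take the pinned regularisation and `R₁` of the femto law;
the volume transfer (fed the pin) gives `R₀`; at `R := max R₀ R₁` the femto law upgrades to the
all-volume moment law, which with domination / no-exceptional-configurations / kinetic edge gives
clause (i) (`separatorLaw_of_momentLaw`, constant `8C`); clauses (ii),(iii) are monotone in `R`. -/
theorem coerciveSeaAt_of_laws
    (hdom : ∀ (N : ℕ) [NeZero N] (U : GaugeConfig 4 N 𝔾) (μ : ℝ) (s : Fin 4 → ℕ) (τ : ℝ),
      0 < τ → HasSingularSeparator U μ s τ → (1 / 8 : ℝ) ≤ twistedMoment U μ s τ)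
    (hobs : ∀ (N : ℕ) [NeZero N] (β μ τ : ℝ) (s : Fin 4 → ℕ) (n : ℕ) (mq : Fin n → ℝ), 0 < τ →
      (∀ U : GaugeConfig 4 N 𝔾, 0 ≤ twistedMoment U μ s τ ∧
          twistedMoment U μ s τ ≤ Fintype.card {p // wilsonBox (0 : TorusSite 4 N) s p}) ∧
        Integrable (fun U : GaugeConfig 4 N 𝔾 => twistedMoment U μ s τ *
            ∏ f, ‖fermionDet (wilsonDirac (fundamentalRep (Fin 3)) U (mq f) 1)‖)
          (wilsonMeasure (d := 4) (L := N) (fundamentalRep (Fin 3)) β))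
    (hkin : ∀ (N : ℕ) [NeZero N] (U : GaugeConfig 4 N 𝔾) (s : Fin 4 → ℕ) (μ τ : ℝ), 0 ≤ τ →
      (∀ i, s i ≤ N) → HasSingularSeparator U μ s τ →
        ∑ i, (1 - Real.cos (Real.pi / s i)) < τ - μ)
    (hfem : ∀ Nf : ℕ, (Nf = 2 ∨ Nf = 3) → ∃ reg : QCDRegularisation Nf, reg.HasMassScaling ∧
      (reg.scheme 0 0 0).HasAsymptoticScaling ∧ ∃ M₀ : ℝ, 0 ≤ M₀ ∧ ∃ b₀ : ℕ, 2 ≤ b₀ ∧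
        ∃ ℓ : ℝ, 0 < ℓ ∧ ∀ m : Fin Nf → ℝ, (∀ f, M₀ < m f) → ∃ R₁ : ℝ, 0 < R₁ ∧
          (∀ R : ℝ, R₁ ≤ R → FemtoMomentLaw Nf reg b₀ ℓ m R) ∧
            DilutionClause Nf reg b₀ ℓ m R₁ ∧ PinClause Nf reg M₀ m R₁)
    (hvol : ∀ Nf : ℕ, (Nf = 2 ∨ Nf = 3) → ∀ (reg : QCDRegularisation Nf) (M₀ : ℝ) (b₀ : ℕ) (ℓ : ℝ)
      (m : Fin Nf → ℝ) (R₁ : ℝ), reg.HasMassScaling → (reg.scheme 0 0 0).HasAsymptoticScaling →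
        0 ≤ M₀ → 2 ≤ b₀ → 0 < ℓ → (∀ f, M₀ < m f) → 0 < R₁ → PinClause Nf reg M₀ m R₁ →
          ∃ R₀ : ℝ, 0 < R₀ ∧ ∀ R : ℝ, R₀ ≤ R → R₁ ≤ R →
            FemtoMomentLaw Nf reg b₀ ℓ m R → MomentLaw Nf reg b₀ ℓ m R) :
    ∀ Nf : ℕ, (Nf = 2 ∨ Nf = 3) → ∃ reg : QCDRegularisation Nf, CoerciveSeaAt Nf reg := by
  intro Nf hNf
  obtain ⟨reg, hms, has, M₀, hM₀, b₀, hb₀, ℓ, hℓ, hm⟩ := hfem Nf hNf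
  refine ⟨reg, hms, has, M₀, hM₀, b₀, hb₀, ℓ, hℓ, fun m hmm => ?_⟩
  obtain ⟨R₁, hR₁, hfemto, hdil, hpin⟩ := hm m hmm
  obtain ⟨R₀, hR₀, hv⟩ := hvol Nf hNf reg M₀ b₀ ℓ m R₁ hms has hM₀ hb₀ hℓ hmm hR₁ hpin
  have h₀ : R₀ ≤ max R₀ R₁ := le_max_left _ _
  have h₁ : R₁ ≤ max R₀ R₁ := le_max_right _ _
  have hmomL : MomentLaw Nf reg b₀ ℓ m (max R₀ R₁) := hv _ h₀ h₁ (hfemto _ h₁)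
  exact ⟨max R₀ R₁, lt_max_of_lt_right hR₁, separatorLaw_of_momentLaw hdom hobs hkin hb₀ hmomL,
    dilutionClause_mono h₁ hdil, pinClause_mono h₁ hpin⟩

/-- **The skeleton theorem `CoerciveSea_of`**: the crux
`Summit.QuantumFields.QCD.Theses.NestedDissectionSea.CoerciveSea` BY NAME from the five registered
stubs (`stub_dominates`, `stub_noExceptional`, `stub_kineticEdge`, `stub_femtoLaw`,
`stub_volumeTransfer`) through the sorry-free composition `coerciveSeaAt_of_laws` and the landed
definitional unfolding `coerciveSea_iff`; every `sorry` of the file sits inside a `stub_*`. -/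
theorem CoerciveSea_of : Summit.QuantumFields.QCD.Theses.NestedDissectionSea.CoerciveSea :=
  coerciveSea_iff.mpr (coerciveSeaAt_of_laws stub_dominates stub_noExceptional stub_kineticEdge
    stub_femtoLaw stub_volumeTransfer)

/-! ## Checks against the landed negative lane (`Theorems/CoerciveSea/Negative/`) -/

/-- Consistency with `PinWindow`: the witness of `stub_femtoLaw` has its pin masses in the open
interval `(−8, 0)` eventually (`PinClause.mass_mem_Ioo`) — the stub keeps the pin, so the heavy junk
regularisation of `coerciveSeaWithoutPin_holds` / `heavyJunk_dichotomy` (for which (i),(ii) are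
junk-true) is NOT a witness of it (`not_coerciveSeaAt_heavyJunkReg` pattern). -/
theorem femtoLaw_pin_mass_mem_Ioo {Nf : ℕ} (hNf : Nf = 2 ∨ Nf = 3) :
    ∃ reg : QCDRegularisation Nf, reg.HasMassScaling ∧ ∃ M₀ : ℝ, 0 ≤ M₀ ∧ ∀ M : ℝ, M₀ < M →
      ∀ᶠ k : ℕ in Filter.atTop, reg.mcrit k - reg.a k * M / reg.Zm k ∈ Set.Ioo (-8 : ℝ) 0 := by
  obtain ⟨reg, hms, -, M₀, hM₀, b₀, -, ℓ, -, hm⟩ := stub_femtoLaw Nf hNf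
  obtain ⟨R₁, -, -, -, hpin⟩ := hm (fun _ => M₀ + 1) (fun _ => by linarith)
  exact ⟨reg, hms, M₀, hM₀, fun M hM => hpin.mass_mem_Ioo hM⟩

/-- Consistency with `CellCoercivity`: `stub_kineticEdge` refines the landed
`hasSingularSeparator_mass_lt` (`μ < |τ|`): for `τ ≥ 0` and `s ≤ N` its conclusion forces `μ < τ`,
since every `1 − cos(π/s_i) ≥ 0`. [folklore] -/
theorem kineticEdge_refines_mass_lt {N : ℕ} [NeZero N] (U : GaugeConfig 4 N 𝔾) (s : Fin 4 → ℕ)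
    (μ τ : ℝ) (hτ : 0 ≤ τ) (hs : ∀ i, s i ≤ N) (h : HasSingularSeparator U μ s τ) : μ < τ := by
  have h1 := stub_kineticEdge N U s μ τ hτ hs h
  have h2 : 0 ≤ ∑ i, (1 - Real.cos (Real.pi / s i)) :=
    Finset.sum_nonneg fun i _ => by linarith [Real.cos_le_one (Real.pi / s i)]
  linarith

end Summit.QuantumFields.QCD.Cruxes.CoerciveSea.TwistedSixthMoment

end
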